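/-
Copyright (c) 2026. Released under Apache 2.0 license as described in the file LICENSE.
-/
import Literature.RepresentationTheory.KonnoKonno2007.JunctionHyperbolicVacuumPin
import HarnessLib

/-!
# The linearised vacuum section of the real unitary dual pair of real rank one (Folland 1989 §4.2, Prop. 4.39)

Literature reproduction (kernel; conventions of Folland 1989 §1.7, (4.23)–(4.24), §4.2 Prop. (4.39); Knapp 2002
Thm 7.39; Konno–Konno 2007 §3.1).  Topic `RepresentationTheory/KonnoKonno2007`; namespaces
`Literature.NumberTheory.Weil1964` (Part A, generic in `KAK` implementer data — stated here, ahead of its natural home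
`Weil1964/ArchVacuumSection`, so that ONE file carries the lever; nothing in Part A mentions the pair) and
`Literature.RepresentationTheory.KonnoKonno2007.RealDualPair` (Part B, the pair `U(P,Q) × U(R,S)`).
RE-HOMING NOTE (carver ruling, content column): Part A is to be re-homed VERBATIM to
`Literature/NumberTheory/Weil1964/ArchVacuumSectionCocycle.lean` by a later seat; its declaration names are final.

**The point of this file.**  `ArchVacuumSection` / `JunctionVacuumSection` construct the vacuum-normalised implementer
section `N = vacSection γ𝕎 : G_∞ → (𝓢 →L[ℂ] 𝓢)` of the pair: covariant, with unitary lifts, jointly continuous, equal to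
Folland's `μ₀` on `K_V × K_W` and to `hypOp` on the boosts (`JunctionHyperbolicVacuumPin`).  It is a PROJECTIVE
representation.  This file decides when an explicit unimodular rescaling of it is an HONEST representation — an
archimedean Weil datum given by a closed formula — and reduces that question to ONE scalar identity between vacuum
overlaps, the kernel target of the squeezed-vacuum computation.

## Part A (generic, `Literature.NumberTheory.Weil1964`)

1. `KAKImplementerData.vacSection_mul` — **the cocycle formula** `N(g h) = m(g, h) • (N(g) ∘ N(h))` with the
   UNIMODULAR Schur multiplier `m(g, h) = ‖v‖ / v = u(v)⁻¹`, `v = schurCoeff γ g h := ⟪k₀, N(g) N(h) h₀⟫ ≠ 0`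
   (`u = unitPhase`, `z ↦ z / ‖z‖`).  Proof: `N(g) ∘ N(h)` implements `γ(g h) = γ g ∘ γ h` (Folland (4.24)), so by the
   Schur remark it is a unimodular multiple of `N(g h)`; the multiple is read off at the vacuum.
2. `schurCoeff_κ_mul_mul_κ`, `schurCoeff_kak`, `schurCoeff_word` — outer compact letters drop out of `v` and inner
   ones move to the middle (`W_K` fixes the Gaussian, Prop. 4.39): the cocycle is determined by three-letter vacuum
   overlaps `⟪k₀, W_A(t) W_K(k) W_A(s) h₀⟫`.
3. `exists_representation_of_cocycle` — **linearisation criterion**: a unimodular `c : G → ℂ` with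
   `c(g h) · m(g, h) = c(g) · c(h)` makes `g ↦ c(g) • N(g)` a representation (produced inside an existential), covariant
   (w2), with unitary lifts (w2′), jointly continuous when `c` is (w1), with `ω(κ k) h₀ = c(κ k) • h₀`; conversely a
   representation of that form forces the cocycle identity (`cocycle_of_mul`).  Also `N(1) = 1`, `m(g,1) = m(1,g) = 1`.

## Part B (the pair, `…KonnoKonno2007.RealDualPair`; `|Q| = 1`, `kV R S` onto)

4. `qEntry`, `bQ`, `aP`, `χ` and their `KAK` algebra: `d(g) = (g_V)_{q₀q₀}`, `d(κ k₁ g κ k₂) = b(k₁) d(g) b(k₂)`,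
   `d(a_t κ k a_s) = b(k) cosh t cosh s + a(k)_{p₀p₀} sinh t sinh s = cosh t cosh s · b(k) · (1 + χ(k) tanh t tanh s)`.
5. `vacOverlap t k s = ⟪k₀, hypOp(t) μ₀(k) hypOp(s) h₀⟫` and the **KERNEL TARGET**
   `VacuumOverlapPhase R S p₀ q₀ m : Prop := ∀ t s k, u(V(t,k,s)) = u(1 + χ(k) tanh t tanh s) ^ m` — NOT a cited fact,
   NOT a claim; consumed only as a hypothesis; to be PROVED by the squeezed-vacuum computation for the `m` it finds.
   Producer sockets for `m = -1`: `vacuumOverlapPhase_neg_one_iff`, `vacuumOverlapPhase_neg_one_of_exists_pos`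
   (any positive real multiple of `(1 + χ tanh t tanh s)⁻¹`), `vacuumOverlapPhase_neg_one_of_eq` (the closed form
   `sech t sech s · (1 + χ tanh t tanh s)⁻¹`), `χ_eq_mul_conj` (`χ = a_{p₀p₀} b̄`); for a general exponent `-n`:
   `vacuumOverlapPhase_neg_natCast_of_exists_pos`.
6. `linWeil m g := u(d(g))^m • N(g)` (a `def` into `𝓢 →ₗ[ℂ] 𝓢`, not a representation) and the **REDUCTION**
   `linPhase_cocycle`: `VacuumOverlapPhase m ⇒ c_m(g h) · m(g, h) = c_m(g) c_m(h)` on all of `G_∞ × G_∞`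
   (`schurCoeff_junction_word`: `v(κ k₁ a_t κ k₂, κ k₃ a_s κ k₄) = V(t, k₂ k₃, s)`).
7. **ASSEMBLY** `isArchWeilDatum_linWeil`: under `VacuumOverlapPhase R S p₀ q₀ m` there is
   `ω : Representation ℂ G_∞ 𝓢` with `ω g = linWeil m g`, `IsArchWeilDatum ι𝕎 ω`, and printed vacuum character
   `ω(κ k) h₀ = vacScalar ⟨0, m, 0, 0⟩ k • h₀`; corollaries for `S = ∅` / `R = ∅` (definite `W` of ANY dimension).
   `linPhase_cocycle_of_representation` is the converse.

Everything is PROVED from Mathlib and the imported tree files; the only hypothesis that is not discharged here is the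
explicitly named internal predicate `VacuumOverlapPhase` (under adjudication; no citation).  What is deliberately NOT
here: the value of `m`, any evaluation of `vacOverlap` (Mehler-kernel / squeezed-vacuum computations), and any claim
about which archimedean Weil representation of the literature `linWeil m` is.

## References

* [Folland1989] G. B. Folland, *Harmonic Analysis in Phase Space*, Annals of Mathematics Studies 122, Princeton
  University Press, 1989: §4.2, (4.23)–(4.24) and the Schur remark p. 156 (an operator intertwining `ρ(p,q)` with
  `ρ(S(p,q))` is unique up to a scalar of modulus one; hence the implementers form a projective representation with
  unimodular multiplier); Prop. (4.39) (the action of `U(σ)` fixes the Gaussian) (doi:10.1515/9781400882427).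
* [Knapp2002] A. W. Knapp, *Lie Groups Beyond an Introduction*, 2nd ed., Progress in Mathematics 140, Birkhäuser,
  2002: Theorem 7.39 (`G = KAK`), p. 457.
* [KonnoKonno2007] K. Konno, T. Konno, Kyushu J. Math. 61 (2007) 35–82: §3.1 (3.1) (the pair and its maximal compact)
  (doi:10.2206/kyushujm.61.35).
-/

noncomputable section

/-! ## Part A.  The Schur cocycle of the vacuum-normalised implementer section (generic `KAK` data) -/

open MeasureTheory Complex SchwartzMap
open scoped InnerProductSpace ComplexConjugate Real

namespace Literature.NumberTheory.Weil1964

open Literature.Analysis.SegalBargmann Literature.RepresentationTheory.HeisenbergGroup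

variable {σ : Type*} [Fintype σ] [DecidableEq σ]

local notation "L2R" σ => Lp ℂ 2 (volume : Measure (σ → ℝ))
local notation "SR" σ => SchwartzMap (σ → ℝ) ℂ
local notation "PV" σ => (σ → ℝ) × (σ → ℝ)

/-- Notation (NOT a definition): `HasUnitaryLift[σ] A` abbreviates the (w2′) clause shape of
`IsArchWeilDatum.exists_lift` — `A : 𝓢 →ₗ 𝓢` is the restriction of SOME unitary operator of `L²(ℝ^σ)`. -/
local notation "HasUnitaryLift[" σ "]" A:max =>
  ∃ U : Lp ℂ 2 (volume : Measure (σ → ℝ)) ≃ₗᵢ[ℂ] Lp ℂ 2 (volume : Measure (σ → ℝ)),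
    LiftsTo A ((LinearIsometryEquiv.toContinuousLinearEquiv U :
        Lp ℂ 2 (volume : Measure (σ → ℝ)) ≃L[ℂ] Lp ℂ 2 (volume : Measure (σ → ℝ))) :
      Lp ℂ 2 (volume : Measure (σ → ℝ)) →L[ℂ] Lp ℂ 2 (volume : Measure (σ → ℝ)))

/-! ## 1. The Schur coefficient and the Schur multiplier -/

section Schur

variable {G : Type*}

/-- The **Schur coefficient** of the section at `(g, h)`: the vacuum coefficient `⟪k₀, N(g) N(h) h₀⟫` of the composite
`N(g) ∘ N(h)`, `N = vacSection γ`. [cite: Folland1989, §4.2, the Schur remark p. 156] -/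
def schurCoeff (γ : G → PhaseMap σ) (g h : G) : ℂ := vacCoeffS ((vacSection γ g).comp (vacSection γ h))

/-- Unfolding `schurCoeff`. [folklore] -/
theorem schurCoeff_apply (γ : G → PhaseMap σ) (g h : G) :
    schurCoeff γ g h = vacCoeffS ((vacSection γ g).comp (vacSection γ h)) := rfl

/-- The **Schur multiplier** `m(g, h) = ‖v‖ / v`, `v = schurCoeff γ g h` (junk value `0` when `v = 0`).
[cite: Folland1989, §4.2, the Schur remark p. 156] -/
def schurMult (γ : G → PhaseMap σ) (g h : G) : ℂ := (‖schurCoeff γ g h‖ : ℂ) / schurCoeff γ g h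

/-- Unfolding `schurMult`. [folklore] -/
theorem schurMult_apply (γ : G → PhaseMap σ) (g h : G) :
    schurMult γ g h = (‖schurCoeff γ g h‖ : ℂ) / schurCoeff γ g h := rfl

/-- `m(g, h) · v = ‖v‖`. [folklore] -/
theorem schurMult_mul_schurCoeff {γ : G → PhaseMap σ} {g h : G} (hv : schurCoeff γ g h ≠ 0) :
    schurMult γ g h * schurCoeff γ g h = (‖schurCoeff γ g h‖ : ℂ) :=
  div_mul_cancel₀ _ hv

/-- The multiplier is unimodular when the coefficient is non-zero. [cite: Folland1989, §4.2, the Schur remark p. 156] -/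
theorem norm_schurMult {γ : G → PhaseMap σ} {g h : G} (hv : schurCoeff γ g h ≠ 0) : ‖schurMult γ g h‖ = 1 := by
  rw [schurMult, norm_div, Complex.norm_real, norm_norm, div_self (norm_ne_zero_iff.2 hv)]

/-- A positive-real coefficient has multiplier `1`. [folklore] -/
theorem schurMult_eq_one_of_eq_norm {γ : G → PhaseMap σ} {g h : G}
    (hpos : schurCoeff γ g h = (‖schurCoeff γ g h‖ : ℂ)) (hv : schurCoeff γ g h ≠ 0) : schurMult γ g h = 1 := by
  rw [schurMult, ← hpos, div_self hv]

end Schur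

/-! ### The unit phase `z ↦ z / ‖z‖` -/

section UnitPhase

/-- The **unit phase** `u(z) = z / ‖z‖` of a complex number (junk value `0` at `z = 0`). [folklore] -/
def unitPhase (z : ℂ) : ℂ := ((‖z‖ : ℂ))⁻¹ * z

/-- Unfolding `unitPhase`. [folklore] -/
theorem unitPhase_apply (z : ℂ) : unitPhase z = ((‖z‖ : ℂ))⁻¹ * z := rfl

/-- `u(0) = 0`. [folklore] -/
@[simp] theorem unitPhase_zero : unitPhase 0 = 0 := by
  rw [unitPhase, mul_zero]

/-- **`u` is multiplicative** (unconditionally, with the junk value). [folklore] -/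
theorem unitPhase_mul (z w : ℂ) : unitPhase (z * w) = unitPhase z * unitPhase w := by
  rw [unitPhase, unitPhase, unitPhase, norm_mul, Complex.ofReal_mul, mul_inv]
  ring

/-- `u(z⁻¹) = u(z)⁻¹`. [folklore] -/
theorem unitPhase_inv (z : ℂ) : unitPhase z⁻¹ = (unitPhase z)⁻¹ := by
  rw [unitPhase, unitPhase, norm_inv, Complex.ofReal_inv, mul_inv, inv_inv]

/-- `u(z / w) = u(z) / u(w)`. [folklore] -/
theorem unitPhase_div (z w : ℂ) : unitPhase (z / w) = unitPhase z / unitPhase w := by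
  rw [div_eq_mul_inv, unitPhase_mul, unitPhase_inv, div_eq_mul_inv]

/-- `u(z ^ m) = u(z) ^ m` for integer powers. [folklore] -/
theorem unitPhase_zpow (z : ℂ) (m : ℤ) : unitPhase (z ^ m) = unitPhase z ^ m := by
  rw [unitPhase, unitPhase, norm_zpow, Complex.ofReal_zpow, mul_zpow, inv_zpow]

/-- `u(z ^ n) = u(z) ^ n`. [folklore] -/
theorem unitPhase_pow (z : ℂ) (n : ℕ) : unitPhase (z ^ n) = unitPhase z ^ n := by
  rw [← zpow_natCast, unitPhase_zpow, zpow_natCast]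

/-- A positive real has unit phase `1`. [folklore] -/
theorem unitPhase_ofReal_of_pos {r : ℝ} (hr : 0 < r) : unitPhase (r : ℂ) = 1 := by
  rw [unitPhase, Complex.norm_real, Real.norm_of_nonneg hr.le, inv_mul_cancel₀]
  exact_mod_cast hr.ne'

/-- Positive real factors drop out: `u(r z) = u(z)` for `r > 0`. [folklore] -/
theorem unitPhase_ofReal_mul {r : ℝ} (hr : 0 < r) (z : ℂ) : unitPhase ((r : ℂ) * z) = unitPhase z := by
  rw [unitPhase_mul, unitPhase_ofReal_of_pos hr, one_mul]

/-- A unimodular number is its own unit phase. [folklore] -/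
theorem unitPhase_of_norm_eq_one {z : ℂ} (hz : ‖z‖ = 1) : unitPhase z = z := by
  rw [unitPhase, hz, Complex.ofReal_one, inv_one, one_mul]

/-- A positive-real complex number (`z = ‖z‖ ≠ 0`) has unit phase `1`. [folklore] -/
theorem unitPhase_of_eq_norm {z : ℂ} (hpos : z = (‖z‖ : ℂ)) (hz : z ≠ 0) : unitPhase z = 1 := by
  rw [unitPhase, ← hpos, inv_mul_cancel₀ hz]

/-- `‖u(z)‖ = 1` for `z ≠ 0`. [folklore] -/
theorem norm_unitPhase {z : ℂ} (hz : z ≠ 0) : ‖unitPhase z‖ = 1 := by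
  rw [unitPhase, norm_mul, norm_inv, Complex.norm_real, norm_norm, inv_mul_cancel₀ (norm_ne_zero_iff.2 hz)]

/-- `u(z) ≠ 0` for `z ≠ 0`. [folklore] -/
theorem unitPhase_ne_zero {z : ℂ} (hz : z ≠ 0) : unitPhase z ≠ 0 := fun h0 => by
  have h1 := norm_unitPhase hz
  rw [h0, norm_zero] at h1
  exact zero_ne_one h1

/-- The vacuum-normalising scalar is the inverse unit phase: `‖z‖ / z = u(z)⁻¹`. [folklore] -/
theorem norm_div_self_eq_inv_unitPhase (z : ℂ) : (‖z‖ : ℂ) / z = (unitPhase z)⁻¹ := by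
  rw [unitPhase, mul_inv, inv_inv, div_eq_mul_inv]

/-- `u` is continuous away from `0`. [folklore] -/
theorem continuousOn_unitPhase : ContinuousOn unitPhase {z : ℂ | z ≠ 0} := by
  refine ContinuousOn.mul (ContinuousOn.inv₀ (Complex.continuous_ofReal.comp continuous_norm).continuousOn
    fun z hz => ?_) continuousOn_id
  show ((‖z‖ : ℝ) : ℂ) ≠ 0
  exact_mod_cast norm_ne_zero_iff.2 hz

variable {G : Type*}

/-- The Schur multiplier is the inverse unit phase of the Schur coefficient: `m(g, h) = u(v(g, h))⁻¹`.
[cite: Folland1989, §4.2, the Schur remark p. 156] -/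
theorem schurMult_eq_inv_unitPhase (γ : G → PhaseMap σ) (g h : G) :
    schurMult γ g h = (unitPhase (schurCoeff γ g h))⁻¹ :=
  norm_div_self_eq_inv_unitPhase _

end UnitPhase

/-! ## 2. The cocycle formula for `KAK` implementer data -/

namespace KAKImplementerData

variable {G : Type*} [Monoid G] [TopologicalSpace G] {K : Type*} [TopologicalSpace K] {P : Type*}
  [TopologicalSpace P] {γ : G → PhaseMap σ} {κ : K → G} {a : P → G} {WK : K → ((SR σ) →L[ℂ] SR σ)}
  {WA : P → ((SR σ) →L[ℂ] SR σ)}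

/-- `N(g) ∘ N(h)` implements `γ (g h)` (Folland's composition rule (4.24) plus `γ (g h) = γ g ∘ γ h`).
[cite: Folland1989, §4.2, (4.24)] -/
theorem isImplementerS_comp (D : KAKImplementerData γ κ a WK WA) (g h : G) :
    IsImplementerS (γ (g * h)) ((vacSection γ g).comp (vacSection γ h)) := by
  have h1 := (D.isImplementerS_vacSection g).comp (D.isImplementerS_vacSection h)
  have hγ : γ (g * h) = γ g ∘ γ h := funext fun pq => D.map_mul g h pq
  rw [hγ]
  exact h1

/-- `‖v(g, h)‖` is the vacuum coefficient of `N(g h)` (two implementers of one map have vacuum coefficients of the same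
modulus). [cite: Folland1989, §4.2, the Schur remark p. 156] -/
theorem norm_schurCoeff (D : KAKImplementerData γ κ a WK WA) (g h : G) :
    (‖schurCoeff γ g h‖ : ℂ) = vacCoeffS (vacSection γ (g * h)) := by
  rw [D.vacCoeffS_vacSection_eq_norm (g * h), schurCoeff,
    (D.isImplementerS_comp g h).norm_vacCoeffS_eq (D.isImplementerS_vacSection (g * h))]

/-- … in particular `v(g, h) ≠ 0`. [cite: Folland1989, §4.2, the Schur remark p. 156] -/
theorem schurCoeff_ne_zero (D : KAKImplementerData γ κ a WK WA) (g h : G) : schurCoeff γ g h ≠ 0 := by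
  intro h0
  apply D.vacCoeffS_vacSection_ne_zero (g * h)
  rw [← D.norm_schurCoeff g h, h0, norm_zero, Complex.ofReal_zero]

/-- The Schur multiplier of `KAK` data is unimodular everywhere. [cite: Folland1989, §4.2, the Schur remark p. 156] -/
theorem norm_schurMult (D : KAKImplementerData γ κ a WK WA) (g h : G) : ‖schurMult γ g h‖ = 1 :=
  Literature.NumberTheory.Weil1964.norm_schurMult (D.schurCoeff_ne_zero g h)

/-- … hence non-zero. [folklore] -/
theorem schurMult_ne_zero (D : KAKImplementerData γ κ a WK WA) (g h : G) : schurMult γ g h ≠ 0 := fun h0 => by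
  have h1 := D.norm_schurMult g h
  rw [h0, norm_zero] at h1
  exact zero_ne_one h1

/-- **The cocycle formula**: `N(g h) = m(g, h) • (N(g) ∘ N(h))`, `m(g, h) = ‖v‖ / v`, `v = ⟪k₀, N(g) N(h) h₀⟫`.
[cite: Folland1989, §4.2, (4.24) and the Schur remark p. 156] -/
theorem vacSection_mul (D : KAKImplementerData γ κ a WK WA) (g h : G) :
    vacSection γ (g * h) = schurMult γ g h • (vacSection γ g).comp (vacSection γ h) := by
  rw [vacSection_eq_vnormS (D.isImplementerS_comp g h) (D.schurCoeff_ne_zero g h)]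
  rfl

/-- The cocycle formula applied to a Schwartz function. [cite: Folland1989, §4.2, the Schur remark p. 156] -/
theorem vacSection_mul_apply (D : KAKImplementerData γ κ a WK WA) (g h : G) (f : SR σ) :
    vacSection γ (g * h) f = schurMult γ g h • vacSection γ g (vacSection γ h f) := by
  rw [D.vacSection_mul g h]
  rfl

/-- Equivalently `N(g) ∘ N(h) = m(g, h)⁻¹ • N(g h)`. [cite: Folland1989, §4.2, the Schur remark p. 156] -/
theorem comp_vacSection_eq (D : KAKImplementerData γ κ a WK WA) (g h : G) :
    (vacSection γ g).comp (vacSection γ h) = (schurMult γ g h)⁻¹ • vacSection γ (g * h) := by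
  rw [D.vacSection_mul g h, smul_smul, inv_mul_cancel₀ (D.schurMult_ne_zero g h), one_smul]

/-! ### `N(1) = 1` and the normalisation `m(g, 1) = m(1, g) = 1` -/

omit [DecidableEq σ] in
/-- The identity operator implements the identity phase-space map. [folklore] -/
theorem _root_.Literature.NumberTheory.Weil1964.isImplementerS_one_id :
    IsImplementerS (id : PhaseMap σ) (1 : (SR σ) →L[ℂ] SR σ) := by
  refine ⟨fun p q f => rfl, ⟨LinearIsometryEquiv.refl ℂ (L2R σ), fun f => ?_⟩⟩
  rfl

/-- **`N(1) = 1`** as soon as `γ 1 = id`: the identity is a vacuum-fixing implementer of `γ 1`.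
[cite: Folland1989, Prop. (4.39)] -/
theorem vacSection_one (D : KAKImplementerData γ κ a WK WA) (hγ1 : γ 1 = id) : vacSection γ (1 : G) = 1 := by
  have hI : IsImplementerS (γ 1) (1 : (SR σ) →L[ℂ] SR σ) := by
    rw [hγ1]
    exact isImplementerS_one_id
  have hv := vacCoeffS_of_apply_hermitePi_zero (W := (1 : (SR σ) →L[ℂ] SR σ)) rfl
  have hv0 : vacCoeffS (1 : (SR σ) →L[ℂ] SR σ) ≠ 0 := by
    rw [hv]
    exact vacL2_norm_sq_ne_zero
  have _ := D
  refine (eq_vacSection hI ?_ hv0).symm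
  rw [hv]
  norm_cast
  rw [Real.norm_of_nonneg (sq_nonneg _)]

/-- `v(g, 1) = vacCoeffS (N g)` (a positive real) when `N(1) = 1`. [folklore] -/
theorem schurCoeff_one_right (D : KAKImplementerData γ κ a WK WA) (hN1 : vacSection γ (1 : G) = 1) (g : G) :
    schurCoeff γ g 1 = vacCoeffS (vacSection γ g) := by
  have _ := D
  rw [schurCoeff, hN1]
  rfl

/-- `v(1, g) = vacCoeffS (N g)` when `N(1) = 1`. [folklore] -/
theorem schurCoeff_one_left (D : KAKImplementerData γ κ a WK WA) (hN1 : vacSection γ (1 : G) = 1) (g : G) :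
    schurCoeff γ 1 g = vacCoeffS (vacSection γ g) := by
  have _ := D
  rw [schurCoeff, hN1]
  rfl

/-- **`m(g, 1) = 1`.** [cite: Folland1989, §4.2, the Schur remark p. 156] -/
theorem schurMult_one_right (D : KAKImplementerData γ κ a WK WA) (hN1 : vacSection γ (1 : G) = 1) (g : G) :
    schurMult γ g 1 = 1 :=
  schurMult_eq_one_of_eq_norm (by rw [D.schurCoeff_one_right hN1]; exact D.vacCoeffS_vacSection_eq_norm g)
    (by rw [D.schurCoeff_one_right hN1]; exact D.vacCoeffS_vacSection_ne_zero g)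

/-- **`m(1, g) = 1`.** [cite: Folland1989, §4.2, the Schur remark p. 156] -/
theorem schurMult_one_left (D : KAKImplementerData γ κ a WK WA) (hN1 : vacSection γ (1 : G) = 1) (g : G) :
    schurMult γ 1 g = 1 :=
  schurMult_eq_one_of_eq_norm (by rw [D.schurCoeff_one_left hN1]; exact D.vacCoeffS_vacSection_eq_norm g)
    (by rw [D.schurCoeff_one_left hN1]; exact D.vacCoeffS_vacSection_ne_zero g)

/-! ## 3. `K`-bi-invariance of the Schur coefficient; reduction to three-letter vacuum overlaps -/

/-- **Outer compact letters drop out of the Schur coefficient**: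
`v(κ k₁ · g, h · κ k₂) = v(g, h)` — `W_K` fixes the Gaussian and is unitary. [cite: Folland1989, Prop. (4.39)] -/
theorem schurCoeff_κ_mul_mul_κ (D : KAKImplementerData γ κ a WK WA) (k₁ : K) (g h : G) (k₂ : K)
    {e : K} (hκe : κ e = 1) (hWe : WK e = 1) :
    schurCoeff γ (κ k₁ * g) (h * κ k₂) = schurCoeff γ g h := by
  have h1 : vacSection γ (κ k₁ * g) = (WK k₁).comp (vacSection γ g) := by
    have h2 := D.vacSection_κ_mul_mul_κ k₁ g e
    rw [hκe, mul_one, hWe] at h2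
    rw [h2]
    rfl
  have h3 : vacSection γ (h * κ k₂) = (vacSection γ h).comp (WK k₂) := by
    have h4 := D.vacSection_κ_mul_mul_κ e h k₂
    rw [hκe, one_mul, hWe] at h4
    rw [h4]
    rfl
  rw [schurCoeff, schurCoeff, h1, h3]
  exact vacCoeffS_comp_comp (X := (vacSection γ g).comp (vacSection γ h)) (D.implK k₁) (D.vacK k₁) (D.implK k₂)
    (D.vacK k₂)

/-- **Inner compact letters move into the middle**: `v(κ k₁ · g · κ k₂, κ k₃ · h · κ k₄) = ⟪k₀, N(g) W_K(k₂) W_K(k₃) N(h) h₀⟫`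
(no unit of `K` needed). [cite: Folland1989, §4.2, the Schur remark p. 156; Prop. (4.39)] -/
theorem schurCoeff_kak (D : KAKImplementerData γ κ a WK WA) (k₁ : K) (g : G) (k₂ k₃ : K) (h : G) (k₄ : K) :
    schurCoeff γ (κ k₁ * g * κ k₂) (κ k₃ * h * κ k₄) =
      vacCoeffS ((vacSection γ g).comp ((WK k₂).comp ((WK k₃).comp (vacSection γ h)))) := by
  rw [schurCoeff, D.vacSection_κ_mul_mul_κ k₁ g k₂, D.vacSection_κ_mul_mul_κ k₃ h k₄]
  exact vacCoeffS_comp_comp (X := (vacSection γ g).comp ((WK k₂).comp ((WK k₃).comp (vacSection γ h))))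
    (D.implK k₁) (D.vacK k₁) (D.implK k₄) (D.vacK k₄)

/-- **On the middle letters the section is the normalised `W_A`**: `N(a t) = (‖w_t‖ / w_t) • W_A t`, `w_t = vacCoeffS (W_A t)`.
[cite: Folland1989, §4.2, the Schur remark p. 156] -/
theorem vacSection_a (D : KAKImplementerData γ κ a WK WA) (t : P) :
    vacSection γ (a t) = ((‖vacCoeffS (WA t)‖ : ℂ) / vacCoeffS (WA t)) • WA t :=
  vacSection_eq_vnormS (D.implA t) (D.vacA t)

/-- **Reduction of the cocycle to three-letter vacuum overlaps**: on `KAK` words,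
`v(κ k₁ a_t κ k₂, κ k₃ a_s κ k₄) = (‖w_t‖/w_t)(‖w_s‖/w_s) · ⟪k₀, W_A(t) W_K(k₂) W_K(k₃) W_A(s) h₀⟫`.
[cite: Folland1989, §4.2, (4.24) and the Schur remark p. 156; Prop. (4.39)] -/
theorem schurCoeff_word (D : KAKImplementerData γ κ a WK WA) (k₁ : K) (t : P) (k₂ k₃ : K) (s : P) (k₄ : K) :
    schurCoeff γ (κ k₁ * a t * κ k₂) (κ k₃ * a s * κ k₄) =
      ((‖vacCoeffS (WA t)‖ : ℂ) / vacCoeffS (WA t)) * (((‖vacCoeffS (WA s)‖ : ℂ) / vacCoeffS (WA s)) *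
        vacCoeffS ((WA t).comp ((WK k₂).comp ((WK k₃).comp (WA s))))) := by
  rw [D.schurCoeff_kak, D.vacSection_a t, D.vacSection_a s, ContinuousLinearMap.comp_smul,
    ContinuousLinearMap.comp_smul, ContinuousLinearMap.comp_smul, ContinuousLinearMap.smul_comp, vacCoeffS_smul,
    vacCoeffS_smul]
  ring

/-! ## 4. The linearisation criterion: unimodular rescalings trivialising the multiplier -/

/-- A representation `ω` with `ω g = c(g) • N(g)`, `c` unimodular, forces the cocycle identity
`c(g h) · m(g, h) = c(g) · c(h)`. [cite: Folland1989, §4.2, the Schur remark p. 156] -/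
theorem cocycle_of_mul (D : KAKImplementerData γ κ a WK WA) {c : G → ℂ}
    {ω : Representation ℂ G (SR σ)}
    (hω : ∀ g f, ω g f = c g • vacSection γ g f) (g h : G) : c (g * h) * schurMult γ g h = c g * c h := by
  have h1 : ω (g * h) (hermitePi 0) = ω g (ω h (hermitePi 0)) := by
    rw [_root_.map_mul]
    rfl
  rw [hω, D.vacSection_mul_apply, hω, hω, map_smul, smul_smul, smul_smul] at h1
  have hne : vacSection γ g (vacSection γ h (hermitePi 0)) ≠ 0 :=
    D.vacSection_apply_ne_zero g (D.vacSection_apply_ne_zero h hermitePi_zero_ne_zero)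
  exact smul_left_injective ℂ hne h1

/-- The value of the rescaled section at `1` is forced: `c(1) = 1` (from the cocycle identity at `(1, 1)` and
`m(1, 1) = 1`, `c(1) ≠ 0`; here and below `N(1) = 1` is a hypothesis, supplied by `vacSection_one` or, on a concrete
group, by `vacSection_κ` at the unit of `K`). [folklore] -/
theorem eq_one_of_cocycle (D : KAKImplementerData γ κ a WK WA) (hN1 : vacSection γ (1 : G) = 1) {c : G → ℂ}
    (hc : ∀ g, ‖c g‖ = 1) (hcoc : ∀ g h, c (g * h) * schurMult γ g h = c g * c h) : c 1 = 1 := by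
  have h1 := hcoc 1 1
  rw [mul_one, D.schurMult_one_right hN1, mul_one] at h1
  have hc0 : c 1 ≠ 0 := fun h0 => by
    have h2 := hc 1
    rw [h0, norm_zero] at h2
    exact zero_ne_one h2
  exact (mul_right_cancel₀ hc0 (by rw [one_mul]; exact h1)).symm

/-- **The linearisation criterion.**  If a unimodular `c : G → ℂ` trivialises the Schur multiplier,
`c(g h) · m(g, h) = c(g) · c(h)`, then `g ↦ c(g) • N(g)` is a representation of `G` on `𝓢(ℝ^σ)`; it is
Heisenberg-covariant over `γ` (w2), has unitary `L²`-lifts (w2′), is jointly continuous as soon as `c` is (w1), and on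
the compact part acts on the Gaussian by the character `c ∘ κ`: `ω(κ k) h₀ = c(κ k) • h₀`.  (The representation is
produced INSIDE the existential: its multiplicativity is exactly the hypothesis `hcoc`, never a definition.)
[cite: Folland1989, §4.2, (4.23)–(4.24) and the Schur remark p. 156; Prop. (4.39)] -/
theorem exists_representation_of_cocycle (D : KAKImplementerData γ κ a WK WA) (hN1 : vacSection γ (1 : G) = 1)
    {c : G → ℂ} (hc : ∀ g, ‖c g‖ = 1) (hcoc : ∀ g h, c (g * h) * schurMult γ g h = c g * c h) :
    ∃ ω : Representation ℂ G (SR σ),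
      (∀ g f, ω g f = c g • vacSection γ g f) ∧
      IsPhaseCovariantS γ (fun g => ω g) ∧
      (∀ g, HasUnitaryLift[σ] (ω g)) ∧
      (∀ k, ω (κ k) (hermitePi 0) = c (κ k) • hermitePi 0) ∧
      (∀ g (f : SR σ), f ≠ 0 → ω g f ≠ 0) ∧
      (Continuous c → Continuous fun x : G × SR σ => ω x.1 x.2) := by
  have hc1 : c 1 = 1 := D.eq_one_of_cocycle hN1 hc hcoc
  let ω : Representation ℂ G (SR σ) :=
    { toFun := fun g => c g • ((vacSection γ g : (SR σ) →L[ℂ] SR σ) : (SR σ) →ₗ[ℂ] SR σ)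
      map_one' := by
        refine LinearMap.ext fun f => ?_
        rw [LinearMap.smul_apply, ContinuousLinearMap.coe_coe, hN1, hc1, one_smul]
        rfl
      map_mul' := fun g h => by
        refine LinearMap.ext fun f => ?_
        rw [LinearMap.smul_apply, ContinuousLinearMap.coe_coe, D.vacSection_mul_apply, smul_smul, hcoc g h,
          Module.End.mul_apply, LinearMap.smul_apply, LinearMap.smul_apply, ContinuousLinearMap.coe_coe,
          ContinuousLinearMap.coe_coe, map_smul, smul_smul] }
  have hω : ∀ g f, ω g f = c g • vacSection γ g f := fun g f => rfl
  refine ⟨ω, hω, fun g p q f => ?_, fun g => ?_, fun k => ?_, fun g f hf => ?_, fun hcc => ?_⟩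
  · rw [hω, hω, (D.isImplementerS_vacSection g).1 p q f, map_smul]
  · obtain ⟨U, hU⟩ := ((D.isImplementerS_vacSection g).smul (hc g)).2
    exact ⟨U, fun f => by rw [← hU f]; rfl⟩
  · rw [hω, D.vacSection_κ k, D.vacK k]
  · rw [hω]
    exact smul_ne_zero (fun h0 => by have h2 := hc g; rw [h0, norm_zero] at h2; exact zero_ne_one h2)
      (D.vacSection_apply_ne_zero g hf)
  · have h1 : (fun x : G × SR σ => ω x.1 x.2) = fun x => c x.1 • vacSection γ x.1 x.2 := funext fun x => hω x.1 x.2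
    rw [h1]
    exact (hcc.comp continuous_fst).smul D.continuous_uncurry_vacSection

end KAKImplementerData

end Literature.NumberTheory.Weil1964

/-! ## Part B.  The real unitary dual pair `U(P,Q) × U(R,S)` of real rank one: the linearised section -/

namespace Literature.RepresentationTheory.KonnoKonno2007

open Literature.Analysis.SegalBargmann Literature.RepresentationTheory.HeisenbergGroup
open Literature.NumberTheory.Weil1964

namespace RealDualPair

open Literature.NumberTheory.Automorphic Literature.NumberTheory.Automorphic.UnitaryGroup

local notation "SR" σ => SchwartzMap (σ → ℝ) ℂ
local notation "PV" σ => (σ → ℝ) × (σ → ℝ)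

/-- Notation (NOT a definition): `HasUnitaryLift[σ] A` abbreviates the (w2′) clause shape of
`IsArchWeilDatum.exists_lift`. -/
local notation "HasUnitaryLift[" σ "]" A:max =>
  ∃ U : Lp ℂ 2 (volume : Measure (σ → ℝ)) ≃ₗᵢ[ℂ] Lp ℂ 2 (volume : Measure (σ → ℝ)),
    LiftsTo A ((LinearIsometryEquiv.toContinuousLinearEquiv U :
        Lp ℂ 2 (volume : Measure (σ → ℝ)) ≃L[ℂ] Lp ℂ 2 (volume : Measure (σ → ℝ))) :
      Lp ℂ 2 (volume : Measure (σ → ℝ)) →L[ℂ] Lp ℂ 2 (volume : Measure (σ → ℝ)))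

variable {P Q : Type*} (R S : Type*) [Fintype P] [DecidableEq P] [Fintype Q] [DecidableEq Q] [Fintype R]
  [DecidableEq R] [Fintype S] [DecidableEq S] (p₀ : P) (q₀ : Q)

-- Notation (NOT a definition): the archimedean symplectic action of `G_∞` on the polarised phase space, as phase
-- maps — `γ𝕎 g = ⇑(ι𝕎 P Q R S g)`.
set_option quotPrecheck false in
local notation "γ𝕎[" P ", " Q ", " R ", " S "]" =>
  fun g : Ginf P Q R S => (⇑((ι𝕎 P Q R S g).1 : (PV (DPIdx P Q R S)) ≃ₗ[ℝ] PV (DPIdx P Q R S)) :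
    PhaseMap (DPIdx P Q R S))

/-! ### B1. The `Q`-entry `d(g)` and its `KAK` algebra (`|Q| = 1`) -/

/-- **`d(g)`**: the `(q₀, q₀)` entry of the `V`-component `g_V ∈ U(P,Q)` of `g = (g_V, g_W) ∈ G_∞` — for `|Q| = 1` the
`1 × 1` block of `g_V` on the negative line `V⁻ = ℂ e_{q₀}`. [folklore] -/
def qEntry (g : Ginf P Q R S) : ℂ :=
  (((g.1 : UForm P Q) : GL (P ⊕ Q) ℂ) : Matrix (P ⊕ Q) (P ⊕ Q) ℂ) (Sum.inr q₀) (Sum.inr q₀)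

/-- **`b(k)`**: the `(q₀, q₀)` entry of the `U(Q)`-component of `k = ((a, b), (c, d)) ∈ K_V × K_W`. [folklore] -/
def bQ (k : DPK P Q R S) : ℂ := (k.1.2 : Matrix Q Q ℂ) q₀ q₀

/-- **`a(k)_{p₀ p₀}`**: the `(p₀, p₀)` entry of the `U(P)`-component of `k ∈ K_V × K_W`. [folklore] -/
def aP (k : DPK P Q R S) : ℂ := (k.1.1 : Matrix P P ℂ) p₀ p₀

/-- **`χ(k) = a(k)_{p₀p₀} / b(k)`** — the ratio entering the three-letter `Q`-entry. [folklore] -/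
def χ (k : DPK P Q R S) : ℂ := aP R S p₀ k / bQ R S q₀ k

/-- `|b(k)| = 1` (`|Q| = 1`: a `1 × 1` unitary). [folklore] -/
theorem norm_bQ [Subsingleton Q] (k : DPK P Q R S) : ‖bQ R S q₀ k‖ = 1 :=
  norm_entry_unitary_subsingleton k.1.2 q₀

/-- `b(k) ≠ 0`. [folklore] -/
theorem bQ_ne_zero [Subsingleton Q] (k : DPK P Q R S) : bQ R S q₀ k ≠ 0 := fun h0 => by
  have h1 := norm_bQ R S q₀ k
  rw [h0, norm_zero] at h1
  exact zero_ne_one h1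

/-- `b` is multiplicative (`|Q| = 1`). [folklore] -/
theorem bQ_mul [Subsingleton Q] (k k' : DPK P Q R S) : bQ R S q₀ (k * k') = bQ R S q₀ k * bQ R S q₀ k' := by
  show ((k.1.2 : Matrix Q Q ℂ) * (k'.1.2 : Matrix Q Q ℂ)) q₀ q₀ = _
  rw [Matrix.mul_apply, Fintype.sum_subsingleton _ q₀]
  rfl

/-- `b(k) = det` of the `U(Q)`-component (`|Q| = 1`). [folklore] -/
theorem bQ_eq_det [Subsingleton Q] (k : DPK P Q R S) : bQ R S q₀ k = (k.1.2 : Matrix Q Q ℂ).det := by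
  rw [Matrix.det_eq_elem_of_subsingleton _ q₀]
  rfl

/-- `|a(k)_{p₀p₀}| ≤ 1` (an entry of a unitary matrix). [folklore] -/
theorem norm_aP_le (k : DPK P Q R S) : ‖aP R S p₀ k‖ ≤ 1 :=
  entry_norm_bound_of_unitary k.1.1.2 p₀ p₀

/-- `b` is continuous. [folklore] -/
theorem continuous_bQ : Continuous (bQ R S q₀ : DPK P Q R S → ℂ) :=
  (continuous_subtype_val.comp (continuous_snd.comp continuous_fst)).matrix_elem q₀ q₀

/-- `d(κ k) = b(k)`. [folklore] -/
theorem qEntry_κ (k : DPK P Q R S) : qEntry R S q₀ (κ P Q R S k) = bQ R S q₀ k := by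
  show (((UForm.kV P Q k.1 : UForm P Q) : GL (P ⊕ Q) ℂ) : Matrix (P ⊕ Q) (P ⊕ Q) ℂ) (Sum.inr q₀) (Sum.inr q₀) = _
  rw [UForm.coe_kV, Matrix.fromBlocks_apply₂₂]
  rfl

/-- `d(a_t) = cosh t`. [folklore] -/
theorem qEntry_hypV (t : ℝ) :
    qEntry R S q₀ ((((hypV p₀ q₀ t : UForm P Q), (1 : UForm R S)) : Ginf P Q R S)) = (Real.cosh t : ℂ) := by
  show (((hypV p₀ q₀ t : UForm P Q) : GL (P ⊕ Q) ℂ) : Matrix (P ⊕ Q) (P ⊕ Q) ℂ) (Sum.inr q₀) (Sum.inr q₀) = _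
  rw [hypV_inr_inr]
  simp only [if_true]

/-- `d(1) = 1`. [folklore] -/
theorem qEntry_one : qEntry R S q₀ (1 : Ginf P Q R S) = 1 := by
  show (((1 : UForm P Q) : GL (P ⊕ Q) ℂ) : Matrix (P ⊕ Q) (P ⊕ Q) ℂ) (Sum.inr q₀) (Sum.inr q₀) = _
  rw [UForm.coe_one, Matrix.one_apply_eq]

/-- **Outer compact letters**: `d(κ k₁ · g · κ k₂) = b(k₁) d(g) b(k₂)` (`|Q| = 1`). [folklore] -/
theorem qEntry_κ_mul_mul_κ [Subsingleton Q] (k₁ : DPK P Q R S) (g : Ginf P Q R S) (k₂ : DPK P Q R S) :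
    qEntry R S q₀ (κ P Q R S k₁ * g * κ P Q R S k₂) = bQ R S q₀ k₁ * qEntry R S q₀ g * bQ R S q₀ k₂ := by
  show (((UForm.kV P Q k₁.1 * g.1 * UForm.kV P Q k₂.1 : UForm P Q) : GL (P ⊕ Q) ℂ) : Matrix (P ⊕ Q) (P ⊕ Q) ℂ)
      (Sum.inr q₀) (Sum.inr q₀) = _
  rw [UForm.coe_mul, UForm.coe_mul, Matrix.mul_apply, Fintype.sum_sum_type]
  simp only [UForm.coe_kV, Matrix.fromBlocks_apply₁₂, Matrix.zero_apply, mul_zero, Finset.sum_const_zero, zero_add,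
    Matrix.fromBlocks_apply₂₂, Fintype.sum_subsingleton _ q₀]
  rw [Matrix.mul_apply, Fintype.sum_sum_type]
  simp only [Matrix.fromBlocks_apply₂₁, Matrix.zero_apply, zero_mul, Finset.sum_const_zero, zero_add,
    Matrix.fromBlocks_apply₂₂, Fintype.sum_subsingleton _ q₀]
  rfl

/-- the `q₀`-row of `a_t · κ k`: `(a_t κ k)_{q₀, e_a} = (i sinh t) a(k)_{p₀ a}`, `(a_t κ k)_{q₀, e_b} = cosh t · b(k)_{q₀ b}`.
[folklore] -/
theorem hypV_mul_kV_inr_apply [Subsingleton Q] (t : ℝ) (k : DPK P Q R S) (j : P ⊕ Q) :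
    ((((hypV p₀ q₀ t : UForm P Q) * UForm.kV P Q k.1 : UForm P Q) : GL (P ⊕ Q) ℂ) : Matrix (P ⊕ Q) (P ⊕ Q) ℂ)
        (Sum.inr q₀) j =
      Sum.elim (fun a => (Real.sinh t : ℂ) * I * (k.1.1 : Matrix P P ℂ) p₀ a)
        (fun b => (Real.cosh t : ℂ) * (k.1.2 : Matrix Q Q ℂ) q₀ b) j := by
  rw [UForm.coe_mul, Matrix.mul_apply, Fintype.sum_sum_type]
  cases j with
  | inl a =>
    simp only [UForm.coe_kV, Matrix.fromBlocks_apply₁₁, Matrix.fromBlocks_apply₂₁, Matrix.zero_apply, mul_zero,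
      Finset.sum_const_zero, add_zero, hypV_inr_inl, true_and, ite_mul, zero_mul, Finset.sum_ite_eq',
      Finset.mem_univ, if_true, Sum.elim_inl]
  | inr b =>
    simp only [UForm.coe_kV, Matrix.fromBlocks_apply₁₂, Matrix.fromBlocks_apply₂₂, Matrix.zero_apply, mul_zero,
      Finset.sum_const_zero, zero_add, hypV_inr_inr, if_true, Fintype.sum_subsingleton _ q₀,
      Subsingleton.elim b q₀, Sum.elim_inr]

/-- **The three-letter `Q`-entry**: `d(a_t · κ k · a_s) = b(k) cosh t cosh s + a(k)_{p₀p₀} sinh t sinh s` (`|Q| = 1`).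
[folklore] -/
theorem qEntry_hypV_mul_κ_mul_hypV [Subsingleton Q] (t s : ℝ) (k : DPK P Q R S) :
    qEntry R S q₀ (((((hypV p₀ q₀ t : UForm P Q), (1 : UForm R S)) : Ginf P Q R S) * κ P Q R S k) *
        (((hypV p₀ q₀ s : UForm P Q), (1 : UForm R S)) : Ginf P Q R S)) =
      bQ R S q₀ k * (Real.cosh t : ℂ) * (Real.cosh s : ℂ) + aP R S p₀ k * (Real.sinh t : ℂ) * (Real.sinh s : ℂ) := by
  show (((((hypV p₀ q₀ t : UForm P Q) * UForm.kV P Q k.1) * (hypV p₀ q₀ s : UForm P Q) : UForm P Q) :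
      GL (P ⊕ Q) ℂ) : Matrix (P ⊕ Q) (P ⊕ Q) ℂ) (Sum.inr q₀) (Sum.inr q₀) = _
  rw [UForm.coe_mul, Matrix.mul_apply, Fintype.sum_sum_type]
  simp only [hypV_mul_kV_inr_apply, Sum.elim_inl, Sum.elim_inr, hypV_inl_inr, hypV_inr_inr, and_true, if_true,
    mul_ite, mul_zero, Finset.sum_ite_eq', Finset.mem_univ, if_true, Fintype.sum_subsingleton _ q₀]
  have hI : I * I = -1 := Complex.I_mul_I
  rw [bQ, aP]
  linear_combination ((Real.sinh t : ℂ) * (k.1.1 : Matrix P P ℂ) p₀ p₀ * (Real.sinh s : ℂ)) * (-hI)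

include p₀ in
/-- **`d ≠ 0` on `G_∞`** (`|Q| = 1`, `kV R S` onto): `d(κ k₁ a_t κ k₂) = b(k₁) cosh t b(k₂)`. [folklore] -/
theorem qEntry_ne_zero [Subsingleton Q] (hW : Function.Surjective (UForm.kV R S)) (g : Ginf P Q R S) :
    qEntry R S q₀ g ≠ 0 := by
  obtain ⟨⟨k₁, t, k₂⟩, rfl⟩ := kakMapPair_surjective p₀ q₀ hW g
  rw [kakMapPair_apply, φ_slExp, qEntry_κ_mul_mul_κ, qEntry_hypV]
  exact mul_ne_zero (mul_ne_zero (bQ_ne_zero R S q₀ k₁) (by exact_mod_cast (Real.cosh_pos t).ne'))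
    (bQ_ne_zero R S q₀ k₂)

/-! ### B2. The three-letter vacuum overlap and the KERNEL TARGET `VacuumOverlapPhase` -/

/-- **The three-letter vacuum overlap** `V(t, k, s) = ⟪k₀, hypOp(t) μ₀(k) hypOp(s) h₀⟫` — the vacuum coefficient of
the word operator `hypOp t ∘ unitaryOpPi (dualPairι k) ∘ hypOp s` on `𝓢(ℝ^{DPIdx})`. [folklore] -/
def vacOverlap (t : ℝ) (k : DPK P Q R S) (s : ℝ) : ℂ :=
  vacCoeffS ((hypOp R S p₀ q₀ t).comp ((unitaryOpPi (dualPairι k)).comp (hypOp R S p₀ q₀ s)))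

/-- **KERNEL TARGET `(★★)_m` — the vacuum-overlap phase identity.**  For an integer `m`:
`∀ t s k, u(V(t, k, s)) = u(1 + χ(k) tanh t tanh s) ^ m`, `u = unitPhase`, `V = vacOverlap`, `χ(k) = a(k)_{p₀p₀} / b(k)`.
This is the statement axioms-2's squeezed-vacuum computation ((K-a) coefficients, (K-b) Hermite-diagonal compression,
(K-c) the overlap formula) is to PROVE in the kernel, for the exponent `m` it finds.  It is NOT a cited fact and NOT a
claim: it carries no citation, is consumed below ONLY as an explicit hypothesis `(hVV : VacuumOverlapPhase R S p₀ q₀ m)`,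
and nothing in this file asserts it.  (Tagged folklore only because every declaration must carry a provenance tag; the
tag asserts nothing about its truth.) [folklore] -/
def VacuumOverlapPhase (m : ℤ) : Prop :=
  ∀ (t s : ℝ) (k : DPK P Q R S),
    unitPhase (vacOverlap R S p₀ q₀ t k s) =
      unitPhase (1 + χ R S p₀ q₀ k * ((Real.tanh t : ℝ) : ℂ) * ((Real.tanh s : ℝ) : ℂ)) ^ m

/-- Unfolding `VacuumOverlapPhase` (for producers: the statement to prove, byte for byte). [folklore] -/
theorem vacuumOverlapPhase_iff (m : ℤ) :
    VacuumOverlapPhase R S p₀ q₀ m ↔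
      ∀ (t s : ℝ) (k : DPK P Q R S),
        unitPhase (vacCoeffS ((hypOp R S p₀ q₀ t).comp ((unitaryOpPi (dualPairι k)).comp (hypOp R S p₀ q₀ s)))) =
          unitPhase (1 + aP R S p₀ k / bQ R S q₀ k * ((Real.tanh t : ℝ) : ℂ) * ((Real.tanh s : ℝ) : ℂ)) ^ m :=
  Iff.rfl

/-- `χ(k) = a(k)_{p₀p₀} · conj b(k)` (`|Q| = 1`: `b⁻¹ = b̄`) — the producer's spelling of the ratio. [folklore] -/
theorem χ_eq_mul_conj [Subsingleton Q] (k : DPK P Q R S) :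
    χ R S p₀ q₀ k = aP R S p₀ k * conj (bQ R S q₀ k) := by
  rw [χ, div_eq_mul_inv, Complex.inv_eq_conj (norm_bQ R S q₀ k)]

/-- `(★★)_{-1}` unfolded: `u(V(t,k,s)) = u(1 + χ(k) tanh t tanh s)⁻¹`. [folklore] -/
theorem vacuumOverlapPhase_neg_one_iff :
    VacuumOverlapPhase R S p₀ q₀ (-1) ↔
      ∀ (t s : ℝ) (k : DPK P Q R S),
        unitPhase (vacOverlap R S p₀ q₀ t k s) =
          (unitPhase (1 + χ R S p₀ q₀ k * ((Real.tanh t : ℝ) : ℂ) * ((Real.tanh s : ℝ) : ℂ)))⁻¹ := by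
  simp only [VacuumOverlapPhase, zpow_neg, zpow_one]

/-- **Producer socket for `(★★)_{-1}`**: if every three-letter vacuum overlap is a POSITIVE REAL multiple of
`(1 + χ(k) tanh t tanh s)⁻¹` — e.g. the geometric-series value `V(t,k,s) = sech t sech s · (1 + χ(k) tanh t tanh s)⁻¹`
of the squeezed-vacuum computation — then `VacuumOverlapPhase R S p₀ q₀ (-1)` holds.  (Nothing here asserts the
hypothesis.) [folklore] -/
theorem vacuumOverlapPhase_neg_one_of_exists_pos
    (hV : ∀ (t s : ℝ) (k : DPK P Q R S), ∃ r : ℝ, 0 < r ∧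
      vacOverlap R S p₀ q₀ t k s =
        (r : ℂ) * (1 + χ R S p₀ q₀ k * ((Real.tanh t : ℝ) : ℂ) * ((Real.tanh s : ℝ) : ℂ))⁻¹) :
    VacuumOverlapPhase R S p₀ q₀ (-1) := by
  rw [vacuumOverlapPhase_neg_one_iff]
  intro t s k
  obtain ⟨r, hr, hV⟩ := hV t s k
  rw [hV, unitPhase_ofReal_mul hr, unitPhase_inv]

/-- **Producer socket, closed form**: `V(t,k,s) = (cosh t)⁻¹ (cosh s)⁻¹ · (1 + χ(k) tanh t tanh s)⁻¹` for all `t, s, k`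
implies `VacuumOverlapPhase R S p₀ q₀ (-1)`.  (Nothing here asserts the hypothesis.) [folklore] -/
theorem vacuumOverlapPhase_neg_one_of_eq
    (hV : ∀ (t s : ℝ) (k : DPK P Q R S),
      vacOverlap R S p₀ q₀ t k s =
        (((Real.cosh t)⁻¹ * (Real.cosh s)⁻¹ : ℝ) : ℂ) *
          (1 + χ R S p₀ q₀ k * ((Real.tanh t : ℝ) : ℂ) * ((Real.tanh s : ℝ) : ℂ))⁻¹) :
    VacuumOverlapPhase R S p₀ q₀ (-1) :=
  vacuumOverlapPhase_neg_one_of_exists_pos R S p₀ q₀ fun t s k =>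
    ⟨_, mul_pos (inv_pos.2 (Real.cosh_pos t)) (inv_pos.2 (Real.cosh_pos s)), hV t s k⟩

/-- **Producer socket, general exponent `-n`** (e.g. `n = |R|` for `S = ∅`, if the three-letter overlap factors
over the `|R|` commuting squeeze planes): if every `V(t,k,s)` is a positive real multiple of
`((1 + χ(k) tanh t tanh s)⁻¹) ^ n`, then `VacuumOverlapPhase R S p₀ q₀ (-n)`.  (Nothing here asserts the hypothesis.)
[folklore] -/
theorem vacuumOverlapPhase_neg_natCast_of_exists_pos (n : ℕ)
    (hV : ∀ (t s : ℝ) (k : DPK P Q R S), ∃ r : ℝ, 0 < r ∧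
      vacOverlap R S p₀ q₀ t k s =
        (r : ℂ) * ((1 + χ R S p₀ q₀ k * ((Real.tanh t : ℝ) : ℂ) * ((Real.tanh s : ℝ) : ℂ))⁻¹) ^ n) :
    VacuumOverlapPhase R S p₀ q₀ (-(n : ℤ)) := by
  intro t s k
  obtain ⟨r, hr, hV⟩ := hV t s k
  rw [hV, unitPhase_ofReal_mul hr, unitPhase_pow, unitPhase_inv, inv_pow, zpow_neg, zpow_natCast]

/-! ### B3. The linearised section `linWeil m` and the reduction of its cocycle to `(★★)_m` -/

/-- **The linearising phase** `c_m(g) = u(d(g)) ^ m`. [folklore] -/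
def linPhase (m : ℤ) (g : Ginf P Q R S) : ℂ := unitPhase (qEntry R S q₀ g) ^ m

/-- **The linearised section** `linWeil m g = u(d(g)) ^ m • N(g)`, `N = vacSection γ𝕎` the vacuum-normalised implementer
section of the pair — a family of linear operators of `𝓢(ℝ^{DPIdx})`, NOT a representation by definition: its
multiplicativity is the content of `isArchWeilDatum_linWeil` under the hypothesis `VacuumOverlapPhase`.
[cite: Folland1989, §4.2, (4.23)–(4.24) and the Schur remark p. 156] -/
def linWeil (m : ℤ) (g : Ginf P Q R S) : (SR (DPIdx P Q R S)) →ₗ[ℂ] SR (DPIdx P Q R S) :=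
  linPhase R S q₀ m g •
    ((vacSection (γ𝕎[P, Q, R, S]) g : (SR (DPIdx P Q R S)) →L[ℂ] SR (DPIdx P Q R S)) :
      (SR (DPIdx P Q R S)) →ₗ[ℂ] SR (DPIdx P Q R S))

/-- Unfolding `linWeil`. [folklore] -/
theorem linWeil_apply (m : ℤ) (g : Ginf P Q R S) (f : SR (DPIdx P Q R S)) :
    linWeil R S q₀ m g f = linPhase R S q₀ m g • vacSection (γ𝕎[P, Q, R, S]) g f := rfl

include p₀ in
/-- `c_m` is unimodular (`|Q| = 1`, `kV R S` onto). [folklore] -/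
theorem norm_linPhase [Subsingleton Q] (hW : Function.Surjective (UForm.kV R S)) (m : ℤ) (g : Ginf P Q R S) :
    ‖linPhase R S q₀ m g‖ = 1 := by
  rw [linPhase, norm_zpow, norm_unitPhase (qEntry_ne_zero R S p₀ q₀ hW g), one_zpow]

/-- `c_m(κ k) = b(k) ^ m = det(b) ^ m`. [folklore] -/
theorem linPhase_κ [Subsingleton Q] (m : ℤ) (k : DPK P Q R S) :
    linPhase R S q₀ m (κ P Q R S k) = (k.1.2 : Matrix Q Q ℂ).det ^ m := by
  rw [linPhase, qEntry_κ, unitPhase_of_norm_eq_one (norm_bQ R S q₀ k), bQ_eq_det]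

/-- **The Schur coefficient of the pair on `KAK` words is the three-letter vacuum overlap**:
`v(κ k₁ a_t κ k₂, κ k₃ a_s κ k₄) = V(t, k₂ k₃, s)` (the section is `hypOp` on the boosts and `μ₀` is a homomorphism).
[cite: Folland1989, §4.2, (4.24) and the Schur remark p. 156; Prop. (4.39)] -/
theorem schurCoeff_junction_word [Subsingleton Q] (hW : Function.Surjective (UForm.kV R S)) (k₁ : DPK P Q R S) (t : ℝ)
    (k₂ k₃ : DPK P Q R S) (s : ℝ) (k₄ : DPK P Q R S) :
    schurCoeff (γ𝕎[P, Q, R, S])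
        (κ P Q R S k₁ * (((hypV p₀ q₀ t : UForm P Q), (1 : UForm R S)) : Ginf P Q R S) * κ P Q R S k₂)
        (κ P Q R S k₃ * (((hypV p₀ q₀ s : UForm P Q), (1 : UForm R S)) : Ginf P Q R S) * κ P Q R S k₄) =
      vacOverlap R S p₀ q₀ t (k₂ * k₃) s := by
  rw [(kakImplementerData_junction R S p₀ q₀ hW).schurCoeff_kak, vacSection_junction_hypV_eq_hypOp,
    vacSection_junction_hypV_eq_hypOp, vacOverlap, _root_.map_mul, unitaryOpPi_mul, ContinuousLinearMap.comp_assoc]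

/-- the three-letter `Q`-entry factorises: `b cosh t cosh s + a sinh t sinh s = (cosh t cosh s) · b · (1 + χ tanh t tanh s)`.
[folklore] -/
theorem qEntry_three_eq [Subsingleton Q] (t s : ℝ) (k : DPK P Q R S) :
    bQ R S q₀ k * (Real.cosh t : ℂ) * (Real.cosh s : ℂ) + aP R S p₀ k * (Real.sinh t : ℂ) * (Real.sinh s : ℂ) =
      ((Real.cosh t * Real.cosh s : ℝ) : ℂ) *
        (bQ R S q₀ k * (1 + χ R S p₀ q₀ k * ((Real.tanh t : ℝ) : ℂ) * ((Real.tanh s : ℝ) : ℂ))) := by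
  have hb := bQ_ne_zero R S q₀ k
  have hct : (Real.cosh t : ℂ) ≠ 0 := by exact_mod_cast (Real.cosh_pos t).ne'
  have hcs : (Real.cosh s : ℂ) ≠ 0 := by exact_mod_cast (Real.cosh_pos s).ne'
  rw [χ, Real.tanh_eq_sinh_div_cosh, Real.tanh_eq_sinh_div_cosh, Complex.ofReal_mul, Complex.ofReal_div,
    Complex.ofReal_div]
  field_simp

/-- **REDUCTION `(★) ⇐ (★★)_m`**: under `VacuumOverlapPhase m` the phase `c_m` trivialises the Schur multiplier of
the pair, `c_m(g h) · m(g, h) = c_m(g) · c_m(h)` on all of `G_∞ × G_∞` — by `KAK`, the outer-letter rule for `d`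
and for `v`, the three-letter entry, and `(★★)_m` at `(t, k₂ k₃, s)`.
[cite: Folland1989, §4.2, (4.24) and the Schur remark p. 156; Prop. (4.39); Knapp2002, Thm 7.39] -/
theorem linPhase_cocycle [Subsingleton Q] (hW : Function.Surjective (UForm.kV R S)) {m : ℤ}
    (hVV : VacuumOverlapPhase R S p₀ q₀ m) (g h : Ginf P Q R S) :
    linPhase R S q₀ m (g * h) * schurMult (γ𝕎[P, Q, R, S]) g h = linPhase R S q₀ m g * linPhase R S q₀ m h := by
  have D := kakImplementerData_junction R S p₀ q₀ hW
  obtain ⟨⟨k₁, t, k₂⟩, rfl⟩ := kakMapPair_surjective p₀ q₀ hW g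
  obtain ⟨⟨k₃, s, k₄⟩, rfl⟩ := kakMapPair_surjective p₀ q₀ hW h
  rw [kakMapPair_apply, kakMapPair_apply, φ_slExp, φ_slExp]
  have hv0 := D.schurCoeff_ne_zero
    (κ P Q R S k₁ * (((hypV p₀ q₀ t : UForm P Q), (1 : UForm R S)) : Ginf P Q R S) * κ P Q R S k₂)
    (κ P Q R S k₃ * (((hypV p₀ q₀ s : UForm P Q), (1 : UForm R S)) : Ginf P Q R S) * κ P Q R S k₄)
  rw [schurCoeff_junction_word R S p₀ q₀ hW] at hv0
  rw [schurMult_eq_inv_unitPhase, schurCoeff_junction_word R S p₀ q₀ hW, hVV t s (k₂ * k₃)]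
  have hY : unitPhase (1 + χ R S p₀ q₀ (k₂ * k₃) * ((Real.tanh t : ℝ) : ℂ) * ((Real.tanh s : ℝ) : ℂ)) ^ m ≠ 0 := by
    rw [← hVV t s (k₂ * k₃)]
    exact unitPhase_ne_zero hv0
  have hprod : κ P Q R S k₁ * (((hypV p₀ q₀ t : UForm P Q), (1 : UForm R S)) : Ginf P Q R S) * κ P Q R S k₂ *
      (κ P Q R S k₃ * (((hypV p₀ q₀ s : UForm P Q), (1 : UForm R S)) : Ginf P Q R S) * κ P Q R S k₄) =
      κ P Q R S k₁ * ((((hypV p₀ q₀ t : UForm P Q), (1 : UForm R S)) : Ginf P Q R S) * κ P Q R S (k₂ * k₃) *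
        (((hypV p₀ q₀ s : UForm P Q), (1 : UForm R S)) : Ginf P Q R S)) * κ P Q R S k₄ := by
    simp only [mul_assoc, _root_.map_mul]
  rw [hprod, linPhase, linPhase, linPhase, qEntry_κ_mul_mul_κ, qEntry_κ_mul_mul_κ, qEntry_κ_mul_mul_κ,
    qEntry_hypV_mul_κ_mul_hypV, qEntry_hypV, qEntry_hypV, qEntry_three_eq, bQ_mul, mul_inv_eq_iff_eq_mul₀ hY]
  simp only [unitPhase_mul, mul_zpow, unitPhase_ofReal_of_pos (Real.cosh_pos t), unitPhase_ofReal_of_pos (Real.cosh_pos s),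
    unitPhase_ofReal_of_pos (mul_pos (Real.cosh_pos t) (Real.cosh_pos s)), mul_one, one_mul]
  ring

/-! ### B4. ASSEMBLY: the archimedean Weil datum `linWeil m` under `(★★)_m` -/

include p₀ q₀ in
/-- `N(1) = 1` for the pair (from `N(κ k) = μ₀(k)` at `k = 1`). [cite: Folland1989, Prop. (4.39)] -/
theorem vacSection_junction_one [Subsingleton Q] (hW : Function.Surjective (UForm.kV R S)) :
    vacSection (γ𝕎[P, Q, R, S]) (1 : Ginf P Q R S) = 1 := by
  have h1 := (kakImplementerData_junction R S p₀ q₀ hW).vacSection_κ 1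
  rw [_root_.map_one, _root_.map_one, unitaryOpPi_one] at h1
  exact h1

/-- **ASSEMBLY — the linearised section is an archimedean Weil datum under `(★★)_m`.**  For the real unitary dual
pair `G_∞ = U(P,Q) × U(R,S)` with `|Q| = 1` (real rank `≤ 1` on the `V` side) and `kV R S : U(R) × U(S) → U(R,S)` onto
(the `W` side compact modulo nothing: `S = ∅` or `R = ∅`, i.e. `W` DEFINITE of any dimension `|R|` resp. `|S|`), and an
integer `m` for which the vacuum-overlap phase identity `VacuumOverlapPhase R S p₀ q₀ m` holds: there is a
representation `ω` of `G_∞` on `𝓢(ℝ^{DPIdx})` with `ω g = linWeil m g = u(d(g))^m • N(g)` for every `g`, which is an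
archimedean Weil datum over `ι𝕎` (Heisenberg covariance (w2), unitary lifts (w2′), strong continuity (w1)), and whose
vacuum character on `K_V × K_W` is the printed one with exponents `(e_P, e_Q, e_R, e_S) = (0, m, 0, 0)`:
`ω(κ k) h₀ = det(b)^m • h₀`.  Slots served: every `WeilPairData`-type slot whose archimedean group is `Ginf P Q R S`
with `|Q| = 1` and `W` definite — for `P = Fin 2`, `Q = Unit` these are the `U(2,1) × U(m)` slots for ALL `m = |R|`
(`dim W_k = 1` AND `dim W_k = 2`, `S = ∅`; symmetrically `R = ∅`), each conditional on ITS instance of the predicate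
(which depends on `R`, `S` through the index type `DPIdx P Q R S`).  The representation is produced INSIDE the
existential; nothing here is a `def … : Representation`.
[cite: Folland1989, §4.2, (4.23)–(4.24) and the Schur remark p. 156; Prop. (4.39); Knapp2002, Thm 7.39] -/
theorem isArchWeilDatum_linWeil [Subsingleton Q] (hW : Function.Surjective (UForm.kV R S)) {m : ℤ}
    (hVV : VacuumOverlapPhase R S p₀ q₀ m) :
    ∃ ω : Representation ℂ (Ginf P Q R S) (SR (DPIdx P Q R S)),
      IsArchWeilDatum (ι𝕎 P Q R S) ω ∧
      (∀ k : DPK P Q R S, ω (κ P Q R S k) (hermitePi 0) = vacScalar ⟨0, m, 0, 0⟩ k • hermitePi 0) ∧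
      ∀ g, ω g = linWeil R S q₀ m g := by
  have D := kakImplementerData_junction R S p₀ q₀ hW
  obtain ⟨ω, hω, hcov, hlift, hvacκ, -, -⟩ := D.exists_representation_of_cocycle
    (vacSection_junction_one R S p₀ q₀ hW) (norm_linPhase R S p₀ q₀ hW m) (linPhase_cocycle R S p₀ q₀ hW hVV)
  have hvac : ∀ k : DPK P Q R S, ω (κ P Q R S k) (hermitePi 0) = vacScalar ⟨0, m, 0, 0⟩ k • hermitePi 0 := fun k => by
    rw [hvacκ k, linPhase_κ, vacScalar]
    simp only [zpow_zero, one_mul, mul_one]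
  exact ⟨ω, isArchWeilDatum_junction_rankOne_of_vacScalar p₀ q₀ ω hcov hlift hvac hW, hvac,
    fun g => LinearMap.ext fun f => hω g f⟩

/-- **Definite `W` on the right** (`S = ∅`: the `U(P,Q) × U(R)` slots, `|Q| = 1`, any `|R|`).
[cite: Folland1989, §4.2 p. 156, Prop. (4.39); Knapp2002, Thm 7.39] -/
theorem isArchWeilDatum_linWeil_of_isEmpty_right [Subsingleton Q] [IsEmpty S] {m : ℤ}
    (hVV : VacuumOverlapPhase R S p₀ q₀ m) :
    ∃ ω : Representation ℂ (Ginf P Q R S) (SR (DPIdx P Q R S)),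
      IsArchWeilDatum (ι𝕎 P Q R S) ω ∧
      (∀ k : DPK P Q R S, ω (κ P Q R S k) (hermitePi 0) = vacScalar ⟨0, m, 0, 0⟩ k • hermitePi 0) ∧
      ∀ g, ω g = linWeil R S q₀ m g :=
  isArchWeilDatum_linWeil R S p₀ q₀ UForm.kV_surjective_of_isEmpty_right hVV

/-- **Definite `W` on the left** (`R = ∅`). [cite: Folland1989, §4.2 p. 156, Prop. (4.39); Knapp2002, Thm 7.39] -/
theorem isArchWeilDatum_linWeil_of_isEmpty_left [Subsingleton Q] [IsEmpty R] {m : ℤ}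
    (hVV : VacuumOverlapPhase R S p₀ q₀ m) :
    ∃ ω : Representation ℂ (Ginf P Q R S) (SR (DPIdx P Q R S)),
      IsArchWeilDatum (ι𝕎 P Q R S) ω ∧
      (∀ k : DPK P Q R S, ω (κ P Q R S k) (hermitePi 0) = vacScalar ⟨0, m, 0, 0⟩ k • hermitePi 0) ∧
      ∀ g, ω g = linWeil R S q₀ m g :=
  isArchWeilDatum_linWeil R S p₀ q₀ UForm.kV_surjective_of_isEmpty_left hVV

include p₀ in
/-- **Converse direction (the cocycle is necessary)**: if SOME unimodular rescaling `g ↦ c(g) • N(g)` of the section is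
a representation, then `c` trivialises the Schur multiplier; in particular if `linWeil m` is (the operator family of)
a representation then `c_m(g h) · m(g, h) = c_m(g) c_m(h)`, which on `KAK` words is `(★★)_m` read backwards.
[cite: Folland1989, §4.2, the Schur remark p. 156] -/
theorem linPhase_cocycle_of_representation [Subsingleton Q] (hW : Function.Surjective (UForm.kV R S)) {m : ℤ}
    {ω : Representation ℂ (Ginf P Q R S) (SR (DPIdx P Q R S))} (hω : ∀ g, ω g = linWeil R S q₀ m g)
    (g h : Ginf P Q R S) :
    linPhase R S q₀ m (g * h) * schurMult (γ𝕎[P, Q, R, S]) g h = linPhase R S q₀ m g * linPhase R S q₀ m h :=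
  (kakImplementerData_junction R S p₀ q₀ hW).cocycle_of_mul (fun g f => by rw [hω]; rfl) g h

end RealDualPair

end Literature.RepresentationTheory.KonnoKonno2007
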